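/-
Copyright: cell ym3-torus (HOME `run/shared/lean/pub/ym3-torus/`), literature seat ym3-torus-lit (gen 8).  Statement-level
record; nothing is claimed beyond what the kernel checks below.
-/
import Literature.MathematicalPhysics.QuantumFieldTheory.WilsonPlaquetteChessboardTail
import Literature.MathematicalPhysics.QuantumFieldTheory.Balaban1983to89.TorusReflectionPositivity
import Literature.MathematicalPhysics.QuantumFieldTheory.Balaban1983to89.T3CruxEstimates
import Literature.MathematicalPhysics.QuantumFieldTheory.Balaban1983to89.HaarSmallBallClosedSubgroup
import Literature.MathematicalPhysics.QuantumFieldTheory.Balaban1983to89.B10Eq71TorusLocal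
import Literature.MathematicalPhysics.QuantumFieldTheory.Balaban1983to89.B10Eq5RegularAction

/-!
# `Balaban1983to89.T3FinestHeightTail` — the FINEST-HEIGHT term of K2's per-height Gibbs tail `HeightTailAt`: the
# single-plaquette large-field tail of the bare `SU(N)` Wilson field on Bałaban's tori, uniformly in the volume
# (cell ym3-torus, rung R3, route `UnitScaleTilt`, crux `HistoryTail`)

statement-level skeleton of published theorems with citation tags; proofs where landed; nothing here is a claim about
the Yang–Mills mass gap

WHAT.  §1 transports the Peierls–chessboard single-plaquette tail of the host tree
(`WilsonPlaquetteTail.measureReal_plaquette_mem_le`, every even torus) to Bałaban's level-0 tori `T^{(0)}` of `Setup`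
(side `2·L^{m+K}`: even, NOT divisible by 4 — the reason the full one-orientation array was needed) and the lattice
Yang–Mills measure `T4GenFunBounds.gibbsMeasure P β` of `G = SU(N)` (dictionary `toConfig`/`ofConfig` of
`TorusReflectionPositivity` §1: product Haar measures correspond, Wilson actions correspond with `β ↦ β/N`):
**`gibbsMeasure_real_dist1_ge_le`** — there is `c = c(N) > 0` such that for every `P : Params`, every `β ≥ 1`, every
`θ ≥ 0` and every plaquette `p` of `T^{(0)}`,
  `(gibbsMeasure P β){U : θ ≤ |U(∂p) − 1|} ≤ 2·e^{8P₂(d)}·(c^d)⁻¹·(√β)^{d(N²−1)}·exp(−βθ²/(2N))`,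
`d = P.d`, `P₂(d) = #{μ < ν}` — chessboard with the link ball `{|u − 1| ≤ β^{−1/2}}` (Haar volume `≥ c β^{−(N²−1)/2}`,
tree `HaarSmallBallClosedSubgroup.haar_ball_ge_specialUnitaryGroup`), energies compared with `|·−1|²` through
[Balaban1985UV3] (11) (`‖U − 1‖² ≤ 2N(1 − Re tr U)`, tree `B10Eq71TorusLocal.dist1_sq_le_specialUnitaryGroup`; `1 − Re tr U ≤ ½‖U − 1‖²`,
tree `B10Eq5RegularAction.one_sub_reTr_le_specialUnitaryGroup`).  UNIFORM IN THE VOLUME: `c` depends on `N` only.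
§2 specialises to the cell's three-dimensional families (`T3Family`, `G = SU(2)`, `β_K = (γε_K)⁻¹`, thresholds
`θ(K) = g_K p(g_K)`, `g_K = √(γε_K)`, tree `θBal`): **`gibbsK_real_not_plaqSmall_le`** — the `j = 0` term of K2's estimate
`T3CruxEstimates.HeightTailAt`,
  `Gibbs_K{U : ¬PlaqSmall θ(K) U} ≤ #P(T^{(0)}_K) · 2e^{24}(c³)⁻¹ · (√β_K)^9 · exp(−p(g_K)²/4)`
(union bound over plaquettes, tree `real_not_plaqSmall_comp_le_sum`; `β_K θ(K)² = p(g_K)²`), i.e. the printed large-field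
factor `exp(−O(1)p(g_k)²)` per plaquette of [Balaban1985UV3] (71) at the finest height, now as a Gibbs-probability
statement, super-polynomially small in `ε_K⁻¹` for Bałaban's profile `p(g) = b₀(1 + log g⁻¹)^{p₀}`, `p₀ > ½`.

WHAT THIS IS NOT: heights `j ≥ 1` of `HeightTailAt` (tails of BLOCK-AVERAGED fields need the renormalization-group
representation of the densities, [Balaban1985UV3] (41)/(71) — averaging is smoothing, a large averaged plaquette does not
force a large bare action); not K1; not a continuum statement; not d = 4 specific (§1 is every `d`, every `N`).

References: [FrohlichIsraelLiebSimon1978] Thm. 4.1 and [OsterwalderSeilerAnnPhys1978] §2 (the engine, host file);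
[Balaban1985UV3] (7) p.257, (11) p.258, (71) p.273; L. Gross, CMP 92 (1983) Thm. 3.6 [Gross1983] (abelian shape).
-/

noncomputable section

open MeasureTheory Filter Topology
open scoped BigOperators

namespace Literature.MathematicalPhysics.QuantumFieldTheory.Balaban1983to89

namespace T3FinestHeightTail

open Literature.MathematicalPhysics.QuantumLattice (fundamentalRep fundamentalRep_apply continuous_fundamentalRep
  fundamentalRep_mem_unitaryGroup)
open T4GenFunBounds (gibbsMeasure integral_gibbsMeasure isProbabilityMeasure_gibbsMeasure)
open Missing (boltzmann partitionFn measurable_plaqHol)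
open scoped Matrix.Norms.L2Operator

/-! ## §1 The single-plaquette tail on Bałaban's tori `T^{(0)}` for `SU(N)`, uniformly in the volume -/

section SUN

variable {N : ℕ} [NeZero N]

/-- For `SU(N)` the product Haar data of `Setup` IS the host tree's `haarProbability` (definitional, `HaarData.ofCompactGroup`).
[folklore] -/
private theorem hhaar_SU : (HaarData.haar : Measure (Matrix.specialUnitaryGroup (Fin N) ℂ)) = haarProbability (Matrix.specialUnitaryGroup (Fin N) ℂ) := rfl

/-- The tree energy `N − Re Tr W` is `N·(1 − reTr W)` (normalised trace of `Setup`). [folklore] -/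
private theorem energy_eq (W : Matrix.specialUnitaryGroup (Fin N) ℂ) :
    (N : ℝ) - (fundamentalRep (Fin N) W).trace.re = (N : ℝ) * (1 - reTr W) := by
  rw [← reTr_mul_card_SU W]; ring

/-- `Re Tr W ≤ N` on `SU(N)` (plaquette energies are non-negative). [folklore] -/
private theorem trace_re_le (W : Matrix.specialUnitaryGroup (Fin N) ℂ) : (fundamentalRep (Fin N) W).trace.re ≤ N := by
  rw [← reTr_mul_card_SU W]
  have := GaugeGroup.reTr_le_one W
  have hN : (0 : ℝ) ≤ N := Nat.cast_nonneg N
  nlinarith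

variable (P : Params)

/-- **THE DICTIONARY CARRIES GIBBS PROBABILITIES**: for `SU(N)` and `β ≥ 0`, the `Setup` Gibbs measure of a measurable event equals the
host tree's Wilson measure, at inverse coupling `β/N` (un-normalised trace), of its preimage under `ofConfig`
(`TorusReflectionPositivity` §1: `measurePreserving_ofConfig`, `wilsonAction_toConfig`; the measure is (1)–(2) of the source:
`ρ₀ = exp[−g₀⁻²A(U)]`, expectations `Z⁻¹∫(·)ρ₀`). [cite: Balaban1985UV3, (1)-(2) p.256] -/
theorem gibbsMeasure_real_eq_wilsonMeasure_real {β : ℝ} (hβ : 0 ≤ β) {S : Set (GaugeField P 0 (Matrix.specialUnitaryGroup (Fin N) ℂ))}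
    (hS : MeasurableSet S) :
    (gibbsMeasure P β).real S =
      (QuantumFieldTheory.wilsonMeasure (d := P.d) (L := P.sitesPerDir 0) (fundamentalRep (Fin N)) (β / N)).real
        ((ofConfig (P := P) (j := 0)) ⁻¹' S) := by
  set ρ := fundamentalRep (Fin N) with hρ
  have hρc : Continuous ρ := continuous_fundamentalRep (Fin N)
  have hNr : (N : ℝ) ≠ 0 := by exact_mod_cast NeZero.ne N
  -- the Boltzmann weight along the dictionary
  have hbol : ∀ V : GaugeConfig P.d (P.sitesPerDir 0) (Matrix.specialUnitaryGroup (Fin N) ℂ),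
      boltzmann P β (ofConfig V) = Real.exp (-(β / N) * QuantumFieldTheory.wilsonAction ρ V) := by
    intro V
    have h := wilsonAction_toConfig (P := P) (j := 0) ρ reTr_mul_card_SU (ofConfig V)
    rw [toConfig_ofConfig] at h
    rw [boltzmann, h]
    congr 1
    field_simp
  -- left-hand side as a ratio of product-Haar integrals
  have hpre : MeasurableSet ((ofConfig (P := P) (j := 0)) ⁻¹' S) := measurable_ofConfig hS
  have hL : (gibbsMeasure P β).real S =
      (∫ V, ((ofConfig (P := P) (j := 0)) ⁻¹' S).indicator 1 V * Real.exp (-(β / N) * QuantumFieldTheory.wilsonAction ρ V)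
          ∂(Measure.pi fun _ : Edge P.d (P.sitesPerDir 0) => haarProbability (Matrix.specialUnitaryGroup (Fin N) ℂ))) /
        ∫ V, Real.exp (-(β / N) * QuantumFieldTheory.wilsonAction ρ V)
          ∂(Measure.pi fun _ : Edge P.d (P.sitesPerDir 0) => haarProbability (Matrix.specialUnitaryGroup (Fin N) ℂ)) := by
    rw [← integral_indicator_one hS, integral_gibbsMeasure P hβ, partitionFn,
      ← integral_comp_ofConfig (P := P) (j := 0) hhaar_SU, ← integral_comp_ofConfig (P := P) (j := 0) hhaar_SU]
    congr 1
    · refine integral_congr_ae (Eventually.of_forall fun V => ?_)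
      simp only [hbol]
      congr 1
    · exact integral_congr_ae (Eventually.of_forall fun V => by simp only [hbol])
  have hR := wilsonExpectation_eq_integral_div (d := P.d) (L := P.sitesPerDir 0) ρ hρc (β / N)
    (((ofConfig (P := P) (j := 0)) ⁻¹' S).indicator 1)
  unfold wilsonExpectation at hR
  rw [hL, ← integral_indicator_one hpre, hR]

/-- The `ofConfig`-preimage of a single-plaquette event of `Setup` is the host tree's single-plaquette event
(`plaquetteHolonomy_toConfig`). [folklore] -/
private theorem preimage_plaq_event (p : Plaq P 0) (E : Set (Matrix.specialUnitaryGroup (Fin N) ℂ)) :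
    (ofConfig (P := P) (j := 0)) ⁻¹' {U : GaugeField P 0 (Matrix.specialUnitaryGroup (Fin N) ℂ) | GaugeField.plaqHol U p ∈ E} =
      {V : GaugeConfig P.d (P.sitesPerDir 0) (Matrix.specialUnitaryGroup (Fin N) ℂ) | plaquetteHolonomy V p.src p.μ p.ν ∈ E} := by
  ext V
  simp only [Set.mem_preimage, Set.mem_setOf_eq]
  rw [← plaquetteHolonomy_toConfig (ofConfig V) p, toConfig_ofConfig]

/-- **THE SINGLE-PLAQUETTE LARGE-FIELD TAIL OF LATTICE `SU(N)` YANG–MILLS ON BAŁABAN'S TORI, UNIFORMLY IN THE VOLUME.**  There is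
`c = c(N) ∈ (0, 1]` such that for every `P : Params` (any dimension `d = P.d`, any size), every `β ≥ 1`, every `θ ≥ 0` and every
plaquette `p` of the finest torus `T^{(0)}`:
`(gibbsMeasure P β){U : θ ≤ |U(∂p) − 1|} ≤ 2·e^{8·P₂(d)}·(c^d)⁻¹·(√β)^{d(N²−1)}·exp(−βθ²/(2N))`, `P₂(d) = #{μ < ν}`.
The Peierls–chessboard bound of the host tree (`WilsonPlaquetteTail.measureReal_plaquette_mem_le`; reflection positivity +
Fröhlich–Israel–Lieb–Simon) with the link ball `{|u − 1| ≤ β^{−1/2}}` (Haar volume `≥ c·β^{−(N²−1)/2}`) and the comparisons (11)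
`|U−1|² ≤ 2N(1 − Re tr U)`, `1 − Re tr U ≤ ½|U−1|²`.  NOT PRINTED as a probability statement; printed neighbours: the abelian
[Gross1983] Thm. 3.6 (shape `C(αβd)^{1/2}e^{−βc}`) and the per-plaquette factor `exp(−¼p(g)²)` of (71).
[cite: Balaban1985UV3, (11) p.258 and (71) p.273; FrohlichIsraelLiebSimon1978, Thm. 4.1] -/
theorem gibbsMeasure_real_dist1_ge_le :
    ∃ c : ℝ, 0 < c ∧ c ≤ 1 ∧ ∀ (P : Params) (β : ℝ), 1 ≤ β → ∀ (θ : ℝ), 0 ≤ θ → ∀ p : Plaq P 0,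
      (gibbsMeasure P β).real {U : GaugeField P 0 (Matrix.specialUnitaryGroup (Fin N) ℂ) | θ ≤ dist1 (GaugeField.plaqHol U p)} ≤
        2 * Real.exp (8 * Fintype.card {q : Fin P.d × Fin P.d // q.1 < q.2}) * (c ^ P.d)⁻¹ *
          Real.sqrt β ^ (P.d * (N ^ 2 - 1)) * Real.exp (-(β * θ ^ 2 / (2 * N))) := by
  obtain ⟨c, hc, hc1, hball⟩ := HaarSmallBallClosedSubgroup.haar_ball_ge_specialUnitaryGroup (n := Fin N) one_pos
  refine ⟨c, hc, hc1, fun P β hβ θ hθ p => ?_⟩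
  set ρ := fundamentalRep (Fin N) with hρdef
  have hρc : Continuous ρ := continuous_fundamentalRep (Fin N)
  have hNr : (0 : ℝ) < N := by exact_mod_cast Nat.pos_of_ne_zero (NeZero.ne N)
  have hβ0 : 0 < β := lt_of_lt_of_le one_pos hβ
  have hβN : 0 ≤ β / N := div_nonneg hβ0.le hNr.le
  -- the radius `r = β^{-1/2}` and the link ball
  set r : ℝ := (Real.sqrt β)⁻¹ with hr
  have hsβ : 0 < Real.sqrt β := Real.sqrt_pos.2 hβ0
  have hr0 : 0 < r := inv_pos.2 hsβ
  have hr1 : r ≤ 1 := by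
    rw [hr]
    exact inv_le_one_of_one_le₀ (Real.one_le_sqrt.2 hβ)
  have hr2 : r ^ 2 = β⁻¹ := by rw [hr, inv_pow, Real.sq_sqrt hβ0.le]
  set B : Set (Matrix.specialUnitaryGroup (Fin N) ℂ) := {g | dist1 g ≤ r} with hB
  have hBm : MeasurableSet B := measurableSet_le RegularGaugeGroup.measurable_dist1 measurable_const
  -- Haar volume of the ball
  have hvol : c * r ^ (N ^ 2 - 1) ≤ (haarProbability (Matrix.specialUnitaryGroup (Fin N) ℂ)).real B := by
    have h := hball (haarProbability (Matrix.specialUnitaryGroup (Fin N) ℂ)) r hr0 hr1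
    rw [Fintype.card_fin] at h
    have hset : {V : Matrix.specialUnitaryGroup (Fin N) ℂ | ‖(V : Matrix (Fin N) (Fin N) ℂ) - 1‖ ≤ r} = B := by
      ext V; rfl
    rw [hset] at h
    rw [measureReal_def]
    exact (ENNReal.ofReal_le_iff_le_toReal (measure_ne_top _ _)).1 h
  have hBpos : 0 < (haarProbability (Matrix.specialUnitaryGroup (Fin N) ℂ)).real B := lt_of_lt_of_le (mul_pos hc (pow_pos hr0 _)) hvol
  -- four-link energies on the ball: `≤ 8 N r²`
  have hBen : ∀ g₁ g₂ g₃ g₄ : Matrix.specialUnitaryGroup (Fin N) ℂ, g₁ ∈ B → g₂ ∈ B → g₃ ∈ B → g₄ ∈ B →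
      (N : ℝ) - (ρ (g₁ * g₂ * g₃⁻¹ * g₄⁻¹)).trace.re ≤ 8 * N * r ^ 2 := by
    intro g₁ g₂ g₃ g₄ h₁ h₂ h₃ h₄
    simp only [hB, Set.mem_setOf_eq] at h₁ h₂ h₃ h₄
    set W := g₁ * g₂ * g₃⁻¹ * g₄⁻¹ with hW
    have hd : dist1 W ≤ 4 * r := by
      calc dist1 W ≤ dist1 (g₁ * g₂ * g₃⁻¹) + dist1 g₄⁻¹ := GaugeGroup.dist1_mul_le _ _
        _ ≤ dist1 (g₁ * g₂) + dist1 g₃⁻¹ + dist1 g₄⁻¹ := by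
            have := GaugeGroup.dist1_mul_le (g₁ * g₂) g₃⁻¹; linarith
        _ ≤ dist1 g₁ + dist1 g₂ + dist1 g₃⁻¹ + dist1 g₄⁻¹ := by
            have := GaugeGroup.dist1_mul_le g₁ g₂; linarith
        _ = dist1 g₁ + dist1 g₂ + dist1 g₃ + dist1 g₄ := by rw [GaugeGroup.dist1_inv, GaugeGroup.dist1_inv]
        _ ≤ 4 * r := by linarith
    have hq := B10Eq5RegularAction.one_sub_reTr_le_specialUnitaryGroup W
    have hd0 : 0 ≤ dist1 W := GaugeGroup.dist1_nonneg W
    rw [energy_eq]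
    have hsq : dist1 W ^ 2 ≤ (4 * r) ^ 2 := pow_le_pow_left₀ hd0 hd 2
    nlinarith
  -- the large-field event: energy `≥ θ²/2`
  set E : Set (Matrix.specialUnitaryGroup (Fin N) ℂ) := {g | θ ≤ dist1 g} with hE
  have hEm : MeasurableSet E := measurableSet_le measurable_const RegularGaugeGroup.measurable_dist1
  have hEconj : ∀ g h : Matrix.specialUnitaryGroup (Fin N) ℂ, h * g * h⁻¹ ∈ E ↔ g ∈ E := fun g h => by
    simp only [hE, Set.mem_setOf_eq, GaugeGroup.dist1_conj]
  have hEinv : ∀ g : Matrix.specialUnitaryGroup (Fin N) ℂ, g⁻¹ ∈ E ↔ g ∈ E := fun g => by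
    simp only [hE, Set.mem_setOf_eq, GaugeGroup.dist1_inv]
  have hEen : ∀ g ∈ E, θ ^ 2 / 2 ≤ (N : ℝ) - (ρ g).trace.re := by
    intro g hg
    simp only [hE, Set.mem_setOf_eq] at hg
    rw [energy_eq]
    have h1 := B10Eq71TorusLocal.dist1_sq_le_specialUnitaryGroup g
    have h2 : θ ^ 2 ≤ dist1 g ^ 2 := pow_le_pow_left₀ hθ hg 2
    linarith
  -- the host-tree bound at `β/N`
  have hmain := WilsonPlaquetteTail.measureReal_plaquette_mem_le (d := P.d) (L := P.sitesPerDir 0) ρ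
    (even_sitesPerDir P 0) hρc trace_re_le hβN hEm hEconj hEinv hEen hBm hBpos hBen p.src (ne_of_lt p.hμν)
  have hSm : MeasurableSet {U : GaugeField P 0 (Matrix.specialUnitaryGroup (Fin N) ℂ) | θ ≤ dist1 (GaugeField.plaqHol U p)} :=
    measurableSet_le measurable_const (RegularGaugeGroup.measurable_dist1.comp (measurable_plaqHol p))
  have hpre : (ofConfig (P := P) (j := 0)) ⁻¹' {U : GaugeField P 0 (Matrix.specialUnitaryGroup (Fin N) ℂ) | θ ≤ dist1 (GaugeField.plaqHol U p)} =
      {V : GaugeConfig P.d (P.sitesPerDir 0) (Matrix.specialUnitaryGroup (Fin N) ℂ) | plaquetteHolonomy V p.src p.μ p.ν ∈ E} :=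
    preimage_plaq_event P p E
  rw [gibbsMeasure_real_eq_wilsonMeasure_real P (by linarith) hSm, hpre]
  refine hmain.trans ?_
  -- arithmetic: `(β/N)(θ²/2) = βθ²/(2N)`, `(β/N)(8Nr²) = 8`, `Haar(B)^d ≥ (c r^{N²-1})^d`
  have e1 : β / N * (θ ^ 2 / 2) = β * θ ^ 2 / (2 * N) := by field_simp
  have e2 : β / N * (8 * N * r ^ 2) = 8 := by rw [hr2]; field_simp
  rw [e1, e2]
  set X := Real.exp (-(β * θ ^ 2 / (2 * N))) with hX
  have hX0 : 0 < X := Real.exp_pos _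
  have hX1 : X ≤ 1 := by
    rw [hX, Real.exp_le_one_iff]
    have : 0 ≤ β * θ ^ 2 / (2 * N) := by positivity
    linarith
  set Y := Real.exp (8 * (Fintype.card {q : Fin P.d × Fin P.d // q.1 < q.2} : ℝ)) with hY
  have hY0 : 0 < Y := Real.exp_pos _
  -- `Haar(B)^d ≥ c^d (√β)^{-d(N²-1)}`
  have hcr : 0 < c * r ^ (N ^ 2 - 1) := mul_pos hc (pow_pos hr0 _)
  have hvol_d : (c * r ^ (N ^ 2 - 1)) ^ P.d ≤ (haarProbability (Matrix.specialUnitaryGroup (Fin N) ℂ)).real B ^ P.d :=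
    pow_le_pow_left₀ hcr.le hvol _
  have hinv : ((haarProbability (Matrix.specialUnitaryGroup (Fin N) ℂ)).real B ^ P.d)⁻¹ ≤ ((c * r ^ (N ^ 2 - 1)) ^ P.d)⁻¹ :=
    inv_anti₀ (pow_pos hcr _) hvol_d
  have hrpow : ((c * r ^ (N ^ 2 - 1)) ^ P.d)⁻¹ = (c ^ P.d)⁻¹ * Real.sqrt β ^ (P.d * (N ^ 2 - 1)) := by
    rw [hr, mul_pow, ← pow_mul, inv_pow, mul_inv, inv_inv, mul_comm (N ^ 2 - 1) P.d]
  calc (1 + X) * X * Y / (haarProbability (Matrix.specialUnitaryGroup (Fin N) ℂ)).real B ^ P.d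
      = (1 + X) * X * Y * ((haarProbability (Matrix.specialUnitaryGroup (Fin N) ℂ)).real B ^ P.d)⁻¹ := by rw [div_eq_mul_inv]
    _ ≤ 2 * X * Y * ((c * r ^ (N ^ 2 - 1)) ^ P.d)⁻¹ := by
        have h12 : (1 + X) * X * Y ≤ 2 * X * Y := by nlinarith [mul_pos hX0 hY0]
        exact mul_le_mul h12 hinv (inv_nonneg.2 (pow_nonneg hBpos.le _)) (by positivity)
    _ = 2 * Y * (c ^ P.d)⁻¹ * Real.sqrt β ^ (P.d * (N ^ 2 - 1)) * X := by rw [hrpow]; ring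

end SUN

/-! ## §2 The cell's three-dimensional families: the `j = 0` term of K2's `HeightTailAt` -/

section T3

open Literature.MathematicalPhysics.QuantumFieldTheory.Balaban1983to89.T3ContinuumYM3Torus
open Literature.MathematicalPhysics.QuantumFieldTheory.Balaban1983to89.T3UnitScaleTilt
open Literature.MathematicalPhysics.QuantumFieldTheory.Balaban1983to89.T3UnitLawDensityEML (ℰp measurableE_ℰp)
open Literature.MathematicalPhysics.QuantumFieldTheory.Balaban1983to89.T3CruxEstimates

variable (F : T3Family)

/-- `β_K θ(K)² = p(g_K)²`: at the finest height the threshold `θ(K) = g_K p(g_K)`, `g_K² = γε_K`, and the bare coupling `β_K = (γε_K)⁻¹`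
combine to the printed exponent `p(g_K)²` ((71): the factor `exp(−¼p(g_k)²)`). [cite: Balaban1985UV3, (7) p.257 and (71) p.273] -/
theorem beta_mul_θBal_sq {γ : ℝ} (hγ : 0 < γ) (b₀ p₀ : ℝ) (K : ℕ) :
    (F.scheme ℰp γ).β K * θBal F.L γ b₀ p₀ K ^ 2 =
      B10.pFun b₀ p₀ (Real.sqrt (γ * ((F.L : ℝ)⁻¹) ^ K)) ^ 2 := by
  have hL : (0 : ℝ) < F.L := by exact_mod_cast lt_trans zero_lt_one F.hL.2
  have hx : 0 < γ * ((F.L : ℝ)⁻¹) ^ K := mul_pos hγ (pow_pos (inv_pos.2 hL) K)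
  show (γ * (F.P K).eps)⁻¹ * θBal F.L γ b₀ p₀ K ^ 2 = _
  have heps : (F.P K).eps = ((F.L : ℝ)⁻¹) ^ K := rfl
  rw [heps, θBal, mul_pow, Real.sq_sqrt hx.le, ← mul_assoc, inv_mul_cancel₀ hx.ne', one_mul]

/-- **THE FINEST-HEIGHT TERM OF K2's ESTIMATE** (`T3CruxEstimates.HeightTailAt` at `j = 0`): for the cell's `SU(2)` families, every `γ > 0`,
every profile `(b₀, p₀)` with `p(g_K) ≥ 0`, and every cutoff `K` with `β_K = (γε_K)⁻¹ ≥ 1`, the Gibbs probability that SOME plaquette of the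
bare field on `T^{(0)}_K` violates `|U(∂p) − 1| < θ(K) = g_K p(g_K)` is at most
`#P(T^{(0)}_K) · 2e^{24}(c³)⁻¹ · (√β_K)^9 · exp(−p(g_K)²/4)` — union bound over plaquettes (`real_not_plaqSmall_comp_le_sum`) and §1 with
`d = 3`, `N = 2` (`P₂(3) = 3`, `N² − 1 = 3`).  The height-`j` terms with `j ≥ 1` (block-averaged fields) are NOT covered.
[cite: Balaban1985UV3, (7) p.257 and (71) p.273] -/
theorem gibbsK_real_not_plaqSmall_le :
    ∃ c : ℝ, 0 < c ∧ c ≤ 1 ∧ ∀ (F : T3Family) (γ : ℝ), 0 < γ → ∀ (b₀ p₀ : ℝ) (K : ℕ),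
      1 ≤ (F.scheme ℰp γ).β K → 0 ≤ B10.pFun b₀ p₀ (Real.sqrt (γ * ((F.L : ℝ)⁻¹) ^ K)) →
        (gibbsK F ℰp γ K).real {U | ¬ PlaqSmall (θBal F.L γ b₀ p₀ K) U} ≤
          Fintype.card (Plaq (F.P K) 0) *
            (2 * Real.exp 24 * (c ^ 3)⁻¹ * Real.sqrt ((F.scheme ℰp γ).β K) ^ 9 *
              Real.exp (-(B10.pFun b₀ p₀ (Real.sqrt (γ * ((F.L : ℝ)⁻¹) ^ K)) ^ 2 / 4))) := by
  obtain ⟨c, hc, hc1, h⟩ := gibbsMeasure_real_dist1_ge_le (N := 2)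
  refine ⟨c, hc, hc1, fun F γ hγ b₀ p₀ K hβ hp => ?_⟩
  haveI := isProbabilityMeasure_gibbsK F ℰp hγ.le K
  have hθ : 0 ≤ θBal F.L γ b₀ p₀ K := mul_nonneg (Real.sqrt_nonneg _) hp
  -- union bound over the plaquettes of `T^{(0)}_K`
  have hunion := real_not_plaqSmall_comp_le_sum (gibbsK F ℰp γ K) (fun U : GaugeField (F.P K) 0 _ => U)
    (θBal F.L γ b₀ p₀ K)
  refine hunion.trans ?_
  -- each plaquette: §1 with `d = 3`, `N = 2`
  have hcard2 : Fintype.card {q : Fin (F.P K).d × Fin (F.P K).d // q.1 < q.2} = 3 := by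
    rw [show (F.P K).d = 3 from rfl]; decide
  have hd3 : (F.P K).d = 3 := rfl
  have hterm : ∀ p : Plaq (F.P K) 0,
      (gibbsK F ℰp γ K).real {U | θBal F.L γ b₀ p₀ K ≤ dist1 (GaugeField.plaqHol U p)} ≤
        2 * Real.exp 24 * (c ^ 3)⁻¹ * Real.sqrt ((F.scheme ℰp γ).β K) ^ 9 *
          Real.exp (-(B10.pFun b₀ p₀ (Real.sqrt (γ * ((F.L : ℝ)⁻¹) ^ K)) ^ 2 / 4)) := by
    intro p
    have hp1 := h (F.P K) ((F.scheme ℰp γ).β K) hβ (θBal F.L γ b₀ p₀ K) hθ p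
    rw [gibbsK_eq]
    refine hp1.trans (le_of_eq ?_)
    rw [hcard2, hd3]
    have hexp : (F.scheme ℰp γ).β K * θBal F.L γ b₀ p₀ K ^ 2 / (2 * (2 : ℕ)) =
        B10.pFun b₀ p₀ (Real.sqrt (γ * ((F.L : ℝ)⁻¹) ^ K)) ^ 2 / 4 := by
      rw [beta_mul_θBal_sq F hγ]; norm_num
    rw [hexp]
    norm_num
  calc ∑ p : Plaq (F.P K) 0, (gibbsK F ℰp γ K).real {U | θBal F.L γ b₀ p₀ K ≤ dist1 (GaugeField.plaqHol U p)}
      ≤ ∑ _p : Plaq (F.P K) 0, (2 * Real.exp 24 * (c ^ 3)⁻¹ * Real.sqrt ((F.scheme ℰp γ).β K) ^ 9 *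
          Real.exp (-(B10.pFun b₀ p₀ (Real.sqrt (γ * ((F.L : ℝ)⁻¹) ^ K)) ^ 2 / 4))) :=
        Finset.sum_le_sum fun p _ => hterm p
    _ = _ := by rw [Finset.sum_const, Finset.card_univ, nsmul_eq_mul]

/-- The `j = 0` instance of the event of `HeightTailAt`: no averaging (`Ū^0 = U`, `K − 0 = K`) — the characteristic function `χ₀`
of (7) constrains the bare plaquette variables. [cite: Balaban1985UV3, (7) p.257] -/
theorem heightTail_event_zero (γ b₀ p₀ : ℝ) (K : ℕ) :
    {U : GaugeField (F.P K) 0 (Matrix.specialUnitaryGroup (Fin 2) ℂ) |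
        ¬ PlaqSmall (θBal F.L γ b₀ p₀ (K - 0))
          (Averaging.iter (fun i => BlockAveraging.blockAvg (P := F.P K) (j := i) ℰp) 0 U)} =
      {U | ¬ PlaqSmall (θBal F.L γ b₀ p₀ K) U} := by
  rfl

end T3

end T3FinestHeightTail

end Literature.MathematicalPhysics.QuantumFieldTheory.Balaban1983to89

end
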